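import Literature.NumberTheory.EllipticCurves.ShimuraCurveHeegnerPointKolyvagin
import Literature.NumberTheory.Automorphic.ShimuraCurveRibetTakahashiComponentPackage
import Literature.NumberTheory.EllipticCurves.Rank1Residual.Predicates
import Summits.BirchSwinnertonDyer.Rank1Residual.X11b.RungK2Leaves
import Summits.BirchSwinnertonDyer.BirchSwinnertonDyer.Theses.ErratumRoadFive

/-! BC3 birth skeleton v3 (REGISTERED FORM, concludes the route decl BY NAME) for crux `ShimuraKolyvaginOrderBoundFromFive` = item stmt-BirchSwinnertonDyer-19627 (K2 annex, 5 ≤ p ∥ N⁺): two image-regime stubs (SHIM-T1 §7.3 transport: Kolyvagin–McCallum–Cha structure argument on X_{N⁺,N⁻} via Nekovář 2007 §4 + (R1)(R2) local triviality) + plan-only BC5 rung (S = ∅ = X₀(N): PRINTED, Cha 2005 Thm 21 / MN19 0.3+§0.11, modulo X_{1,N} = X₀(N)); `_of` by cases on Surj W p; sorries ONLY in stub_*. -/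

noncomputable section

open scoped Classical

namespace Summit.BirchSwinnertonDyer.BirchSwinnertonDyer.Cruxes.ShimuraKolyvaginOrderBoundFromFive.Birth

open NumberField CongruenceSubgroup Literature.NumberTheory.Automorphic
  Literature.NumberTheory.EllipticCurves.ModularForms
  Literature.NumberTheory.EllipticCurves

/-! The crux decl is the ROUTE decl `Summit.BirchSwinnertonDyer.BirchSwinnertonDyer.Theses.ErratumRoadFive.ShimuraKolyvaginOrderBoundFromFive`
(item stmt-BirchSwinnertonDyer-19627, ErratumRoadFive rev 9). -/

/-- stub (surjective mod-p image (p ≥ 5)): KL89/91 + KL §7 transport need a JACOBIAN parametrisation and p ∤ N; at p ∣ N⁺, p ≥ 5 the (R1)+(R2) local conditions at v ∣ 3 are the new input. -/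
theorem stub_orderBound_surjFromFive :
  ∀ (W : WeierstrassCurve ℚ) [W.IsElliptic] [W.IsGloballyMinimal] (p : ℕ) [Fact p.Prime]
    (N : ℕ) [NeZero N] (K : Type) [Field K] [NumberField K] (S : Finset ℕ)
    (Dt : ModularParametrizationData W N)
    (X : ShimuraCurveData (∏ q ∈ S, q) (N / ∏ q ∈ S, q))
    (W' : WeierstrassCurve ℚ) [W'.IsElliptic] (P₀ : ShimuraParametrizationData X W'),
    W.conductorNorm ℤ = N → Literature.NumberTheory.EllipticCurves.Rank1Residual.Surj W p → p ≠ 2 → W.HasIrreducibleModPGaloisRep p →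
    IsImaginaryQuadratic K → Even S.card →
    (∀ ℓ ∈ S, ℓ.Prime ∧ ℓ ∣ N ∧ ¬ ℓ ^ 2 ∣ N ∧
      ((Ideal.span {(ℓ : ℤ)}).primesOver (𝓞 K)).ncard = 1 ∧ ¬ (ℓ : ℤ) ∣ NumberField.discr K) →
    (∀ ℓ : ℕ, ℓ.Prime → ℓ ∣ N → ℓ ∉ S → ((Ideal.span {(ℓ : ℤ)}).primesOver (𝓞 K)).ncard = 2) →
    ((Ideal.span {(p : ℤ)}).primesOver (𝓞 K)).ncard = 2 →
    P₀.IsMinimalFor W →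
    p ∣ N → 5 ≤ p →
    ∀ (P : (W.baseChange K).toAffine.Point) (degS : ℕ), 0 < degS →
      padicValNat p degS = padicValNat p P₀.deg →
      LDerivEK W K =
        8 * (Real.pi : ℂ) ^ 2 * peterssonProduct (Gamma0 N) 2 Dt.f Dt.f /
            ((((Units.torsionOrder K : ℝ) / 2) ^ 2 * √|(NumberField.discr K : ℝ)| : ℝ) : ℂ) *
          ((P.canonicalHeight : ℂ) / (degS : ℂ)) →
      ¬ IsOfFinAddOrder P →
        Nat.card (AddCommGroup.primaryComponent (W.baseChange K).sha p) ≤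
          p ^ (2 * padicValNat p (AddSubgroup.zmultiples P).index) := by
  sorry

/-- stub (irreducible non-surjective mod-p image (p ≥ 5)): Cha 2005 §5 / MN19 on X₀(N); nothing printed on X_{N⁺,N⁻} with p ∣ N⁺ (p ≥ 5) (D-AUDIT Table C). -/
theorem stub_orderBound_irredNonSurjFromFive :
  ∀ (W : WeierstrassCurve ℚ) [W.IsElliptic] [W.IsGloballyMinimal] (p : ℕ) [Fact p.Prime]
    (N : ℕ) [NeZero N] (K : Type) [Field K] [NumberField K] (S : Finset ℕ)
    (Dt : ModularParametrizationData W N)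
    (X : ShimuraCurveData (∏ q ∈ S, q) (N / ∏ q ∈ S, q))
    (W' : WeierstrassCurve ℚ) [W'.IsElliptic] (P₀ : ShimuraParametrizationData X W'),
    W.conductorNorm ℤ = N → ¬ Literature.NumberTheory.EllipticCurves.Rank1Residual.Surj W p → p ≠ 2 → W.HasIrreducibleModPGaloisRep p →
    IsImaginaryQuadratic K → Even S.card →
    (∀ ℓ ∈ S, ℓ.Prime ∧ ℓ ∣ N ∧ ¬ ℓ ^ 2 ∣ N ∧
      ((Ideal.span {(ℓ : ℤ)}).primesOver (𝓞 K)).ncard = 1 ∧ ¬ (ℓ : ℤ) ∣ NumberField.discr K) →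
    (∀ ℓ : ℕ, ℓ.Prime → ℓ ∣ N → ℓ ∉ S → ((Ideal.span {(ℓ : ℤ)}).primesOver (𝓞 K)).ncard = 2) →
    ((Ideal.span {(p : ℤ)}).primesOver (𝓞 K)).ncard = 2 →
    P₀.IsMinimalFor W →
    p ∣ N → 5 ≤ p →
    ∀ (P : (W.baseChange K).toAffine.Point) (degS : ℕ), 0 < degS →
      padicValNat p degS = padicValNat p P₀.deg →
      LDerivEK W K =
        8 * (Real.pi : ℂ) ^ 2 * peterssonProduct (Gamma0 N) 2 Dt.f Dt.f /
            ((((Units.torsionOrder K : ℝ) / 2) ^ 2 * √|(NumberField.discr K : ℝ)| : ℝ) : ℂ) *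
          ((P.canonicalHeight : ℂ) / (degS : ℂ)) →
      ¬ IsOfFinAddOrder P →
        Nat.card (AddCommGroup.primaryComponent (W.baseChange K).sha p) ≤
          p ^ (2 * padicValNat p (AddSubgroup.zmultiples P).index) := by
  sorry

/-- plan-only BC5 rung (S = ∅, N⁻ = 1, the modular curve): PRINTED for X₀(N) at p ≥ 5, p ∥ N, E[3] irreducible (Cha 2005 Thm 21; MN19 Thm 0.3 + §0.11); as typed needs X_{1,N} = X₀(N) (transport of structure); outside S's known regime (no printed p-part of BSD at p ≥ 5, p ∥ N). -/
theorem stub_rung_orderBound_SEmptyFromFive :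
  ∀ (W : WeierstrassCurve ℚ) [W.IsElliptic] [W.IsGloballyMinimal] (p : ℕ) [Fact p.Prime]
    (N : ℕ) [NeZero N] (K : Type) [Field K] [NumberField K] (S : Finset ℕ)
    (Dt : ModularParametrizationData W N)
    (X : ShimuraCurveData (∏ q ∈ S, q) (N / ∏ q ∈ S, q))
    (W' : WeierstrassCurve ℚ) [W'.IsElliptic] (P₀ : ShimuraParametrizationData X W'),
    W.conductorNorm ℤ = N → S = ∅ → p ≠ 2 → W.HasIrreducibleModPGaloisRep p →
    IsImaginaryQuadratic K → Even S.card →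
    (∀ ℓ ∈ S, ℓ.Prime ∧ ℓ ∣ N ∧ ¬ ℓ ^ 2 ∣ N ∧
      ((Ideal.span {(ℓ : ℤ)}).primesOver (𝓞 K)).ncard = 1 ∧ ¬ (ℓ : ℤ) ∣ NumberField.discr K) →
    (∀ ℓ : ℕ, ℓ.Prime → ℓ ∣ N → ℓ ∉ S → ((Ideal.span {(ℓ : ℤ)}).primesOver (𝓞 K)).ncard = 2) →
    ((Ideal.span {(p : ℤ)}).primesOver (𝓞 K)).ncard = 2 →
    P₀.IsMinimalFor W →
    p ∣ N → 5 ≤ p →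
    ∀ (P : (W.baseChange K).toAffine.Point) (degS : ℕ), 0 < degS →
      padicValNat p degS = padicValNat p P₀.deg →
      LDerivEK W K =
        8 * (Real.pi : ℂ) ^ 2 * peterssonProduct (Gamma0 N) 2 Dt.f Dt.f /
            ((((Units.torsionOrder K : ℝ) / 2) ^ 2 * √|(NumberField.discr K : ℝ)| : ℝ) : ℂ) *
          ((P.canonicalHeight : ℂ) / (degS : ℂ)) →
      ¬ IsOfFinAddOrder P →
        Nat.card (AddCommGroup.primaryComponent (W.baseChange K).sha p) ≤
          p ^ (2 * padicValNat p (AddSubgroup.zmultiples P).index) := by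
  sorry

/-! ## Stub statements by name -/

namespace Statement

/-- Statement of `stub_orderBound_surjFromFive`. -/
abbrev stub_orderBound_surjFromFive : Prop := type_of% @Birth.stub_orderBound_surjFromFive
/-- Statement of `stub_orderBound_irredNonSurjFromFive`. -/
abbrev stub_orderBound_irredNonSurjFromFive : Prop := type_of% @Birth.stub_orderBound_irredNonSurjFromFive
/-- Statement of `stub_rung_orderBound_SEmptyFromFive` (plan-only BC5 rung; not used by `ShimuraKolyvaginOrderBoundFromFive_of`). -/
abbrev stub_rung_orderBound_SEmptyFromFive : Prop := type_of% @Birth.stub_rung_orderBound_SEmptyFromFive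

end Statement

/-! ## The composition (sorry-free): the two image-regime stub STATEMENTS imply the crux, BY NAME -/

theorem ShimuraKolyvaginOrderBoundFromFive_of (hS : Statement.stub_orderBound_surjFromFive)
    (hN : Statement.stub_orderBound_irredNonSurjFromFive) :
    Summit.BirchSwinnertonDyer.BirchSwinnertonDyer.Theses.ErratumRoadFive.ShimuraKolyvaginOrderBoundFromFive := by
  intro W _ _ p _ N _ K _ _ S Dt X W' _ P₀ hcond
  by_cases hs : Literature.NumberTheory.EllipticCurves.Rank1Residual.Surj W p
  · exact hS W p N K S Dt X W' P₀ hcond hs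
  · exact hN W p N K S Dt X W' P₀ hcond hs

/-- The crux along this line, MODULO exactly the two registered image-regime stubs (sorries live only in `stub_*`). -/
theorem ShimuraKolyvaginOrderBoundFromFive_proof :
    Summit.BirchSwinnertonDyer.BirchSwinnertonDyer.Theses.ErratumRoadFive.ShimuraKolyvaginOrderBoundFromFive :=
  ShimuraKolyvaginOrderBoundFromFive_of stub_orderBound_surjFromFive stub_orderBound_irredNonSurjFromFive

end Summit.BirchSwinnertonDyer.BirchSwinnertonDyer.Cruxes.ShimuraKolyvaginOrderBoundFromFive.Birth

end
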